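import Mathlib

/-!
# `NewtonUnitEquationsNewtonTauWeakThreeCoreExposed` — the three-core exact-cover family has `3 ^ x`
# strictly positively exposed points

Line `binomial-normal-form` of crux `NewtonTauWeak` (stmt-ValiantsHypothesis-5904), lead c7, rung C7b, stub P5
(`stub_threeCoreExposed`, the registered text verbatim).  It is the LOWER-BOUND calibration of the exact-cover
shadow bound (`exactCoverShadow_of_T2`): an exact-cover cloud on `r = x + 3` points with `N = 3 · 2 ^ x` items
realising `3 ^ x` strictly positively exposed points.

## The construction (the "three-core family")

Items are indexed, through a bijection `e : Fin (3 · 2^x) ≃ Fin 3 × Finset (Fin x)`, by a core `i ∈ Fin 3` and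
a set `S` of attached coordinates.  Coordinates `Fin (x + 3) = Fin x ⊕ Fin 3` (`Fin.castAdd 3 u` attached,
`Fin.natAdd x i` core); the label of `(i, S)` is the indicator of `S ∪ {core i}` (a `Fin.append`).  With the
base-`3` weight `W⟦S⟧ = Σ_{u ∈ S} 3^u` and `M = W⟦univ⟧` the costs are the planar points
`(0, 2W² + 4MW)`, `(W, W·W⟦Sᶜ⟧ + 3MW)`, `(2W, 2W²)` for the cores `0, 1, 2` (`W = W⟦S⟧`; no subtraction).

* Exact covers are exactly the triples `{(0, S₀), (1, S₁), (2, S₂)}` with `S₀, S₁, S₂` a partition of `Fin x`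
  (the item covering core `i` is unique and every item covers its own core; attached coordinates are covered
  once iff the sets partition), i.e. the level sets of a digit function `f : Fin x → Fin 3`.
* The point of such a cover is `(X, Z² + 2M²)` with `X = W₁ + 2W₂ = Σ_u f(u)·3^u`, `Z = 2W₀ + W₁`, `X + Z = 2M`
  (the identity `2W₀² + 4MW₀ + W₁(M - W₁) + 3MW₁ + 2W₂² = (2W₀ + W₁)² + 2M²` on `W₀ + W₁ + W₂ = M`): all points lie
  on one parabola, and `f ↦ X` is injective (base-`3` digits), so there are `3 ^ x` of them.
* Each parabola point `(X, Z² + 2M²)` is strictly exposed by the positive weight `w = (4Z + 1, 2)`: over the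
  parabola the increment of `w · (point)` is `D(2D - 1) > 0`, `D = Z' - Z ∈ ℤ ∖ {0}`.
* The exposed set is contained in the finite set of all subfamily sums, so `Set.ncard` is monotone on it.

Main result: `stub_threeCoreExposed` (registered signature).  Helpers in the sub-namespace `ThreeCoreExposedAux`,
with two file-local notations `W⟦S⟧`, `M⟦x⟧` (pure notation: no definitions, no named facts; Mathlib only;
everything is [folklore]).
-/

-- justification: the namespace mandated for this Theorems file repeats the component `ValiantsHypothesis`
set_option linter.dupNamespace false -- single-conjunct summit layout `ValiantsHypothesis.ValiantsHypothesis`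

noncomputable section

open scoped BigOperators

namespace Summit.ValiantsHypothesis.ValiantsHypothesis.Theorems.NewtonUnitEquationsNewtonTauWeak

/-- `W⟦S⟧ = Σ_{u ∈ S} 3^u`: the base-`3` weight of a set of attached coordinates (file-local notation). -/
local notation3 (prettyPrint := false) "W⟦" S "⟧" => Finset.sum S (fun u => (3 : ℕ) ^ (u : ℕ))

/-- `M⟦x⟧ = Σ_{u < x} 3^u = W⟦univ⟧`: the total base-`3` weight (file-local notation). -/
local notation3 (prettyPrint := false) "M⟦" x "⟧" =>
  Finset.sum (Finset.univ : Finset (Fin x)) (fun u => (3 : ℕ) ^ (u : ℕ))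

namespace ThreeCoreExposedAux

open Finset

/-! ## §1 Base-`3` digit sums -/

/-- Peeling off the lowest base-`3` digit of `Σ_u f(u)·3^u`. [folklore] -/
theorem digitSum_succ (x : ℕ) (f : Fin (x + 1) → Fin 3) :
    ∑ u, (f u : ℕ) * 3 ^ (u : ℕ) = (f 0 : ℕ) + 3 * ∑ u : Fin x, (f u.succ : ℕ) * 3 ^ (u : ℕ) := by
  rw [Fin.sum_univ_succ, Finset.mul_sum]
  simp only [Fin.val_zero, pow_zero, mul_one, Fin.val_succ, pow_succ]
  congr 1
  exact Finset.sum_congr rfl fun u _ => by ring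

/-- Base-`3` expansions with digits in `{0, 1, 2}` are unique: `f ↦ Σ_u f(u)·3^u` is injective on
`Fin x → Fin 3`. [folklore] -/
theorem digitSum_injective : ∀ (x : ℕ) (f f' : Fin x → Fin 3),
    ∑ u, (f u : ℕ) * 3 ^ (u : ℕ) = ∑ u, (f' u : ℕ) * 3 ^ (u : ℕ) → f = f'
  | 0, f, f', _ => funext fun u => u.elim0
  | x + 1, f, f', h => by
    rw [digitSum_succ, digitSum_succ] at h
    have h0 := (f 0).isLt
    have h0' := (f' 0).isLt
    have hd : (f 0 : ℕ) = f' 0 := by omega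
    have ht : ∑ u : Fin x, (f u.succ : ℕ) * 3 ^ (u : ℕ) = ∑ u : Fin x, (f' u.succ : ℕ) * 3 ^ (u : ℕ) := by
      omega
    have htail := digitSum_injective x (fun u => f u.succ) (fun u => f' u.succ) ht
    funext u
    refine Fin.cases ?_ (fun v => ?_) u
    · exact Fin.ext hd
    · exact congrFun htail v

/-- A digit `d ∈ {0, 1, 2}` contributes `d·P = [d = 1]·P + 2·[d = 2]·P`. [folklore] -/
theorem digit_split (d : Fin 3) (P : ℕ) :
    (if d = 1 then P else 0) + 2 * (if d = 2 then P else 0) = (d : ℕ) * P := by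
  fin_cases d <;> simp

/-- The digit sum of `f` through its level sets: `W⟦f⁻¹ 1⟧ + 2·W⟦f⁻¹ 2⟧ = Σ_u f(u)·3^u`. [folklore] -/
theorem digitSum_eq (x : ℕ) (f : Fin x → Fin 3) :
    W⟦(univ.filter fun u => f u = 1)⟧ + 2 * W⟦(univ.filter fun u => f u = 2)⟧ =
      ∑ u, (f u : ℕ) * 3 ^ (u : ℕ) := by
  rw [Finset.sum_filter, Finset.sum_filter, Finset.mul_sum, ← Finset.sum_add_distrib]
  exact Finset.sum_congr rfl fun u _ => digit_split (f u) _

/-! ## §2 The parabola: the cost identity and strict exposure -/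

/-- The parabola identity behind the three-core costs: with `B₀ + B₁ + B₂ = M` and `B₁ + C₁ = M`,
`2B₀² + 4MB₀ + (B₁C₁ + 3MB₁) + 2B₂² = (2B₀ + B₁)² + 2M²`. [folklore] -/
theorem parabola_identity (B0 B1 B2 C1 M : ℕ) (hM : B0 + B1 + B2 = M) (hC : B1 + C1 = M) :
    2 * B0 ^ 2 + 4 * M * B0 + (B1 * C1 + 3 * M * B1) + 2 * B2 ^ 2 = (2 * B0 + B1) ^ 2 + 2 * M ^ 2 := by
  obtain rfl : C1 = B0 + B2 := by omega
  subst hM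
  ring

/-- Strict exposure on the parabola `X + Z = const`, `Y = Z² + C`: the functional `(4Z + 1)·X' + 2·Y'` over
the parabola points `(X', Y')` is uniquely minimised at `(X, Y)` (its increment is `D(2D - 1) > 0`,
`D = Z' - Z ∈ ℤ ∖ {0}`). [folklore] -/
theorem parabola_exposed {X Z X' Z' : ℕ} (C : ℕ) (h : X + Z = X' + Z') (hne : X ≠ X') :
    (4 * Z + 1) * X + 2 * (Z ^ 2 + C) < (4 * Z + 1) * X' + 2 * (Z' ^ 2 + C) := by
  rcases Nat.lt_or_gt_of_ne hne with hlt | hlt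
  · obtain ⟨d, rfl⟩ := Nat.exists_eq_add_of_lt hlt
    obtain rfl : Z = Z' + d + 1 := by omega
    nlinarith [sq_nonneg d]
  · obtain ⟨d, rfl⟩ := Nat.exists_eq_add_of_lt hlt
    obtain rfl : Z' = Z + d + 1 := by omega
    nlinarith [sq_nonneg d]

/-- Positive weights exposing a parabola point among the parabola points: `w = (4Z + 1, 2)`. [folklore] -/
theorem exposed_weights (T C X Z : ℕ) (hXZ : X + Z = T) :
    ∃ w : Fin 2 → ℝ, 0 < w 0 ∧ 0 < w 1 ∧ ∀ X' Z' : ℕ, X' + Z' = T → X' ≠ X →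
      w 0 * (X : ℝ) + w 1 * ((Z ^ 2 + C : ℕ) : ℝ) < w 0 * (X' : ℝ) + w 1 * ((Z' ^ 2 + C : ℕ) : ℝ) := by
  refine ⟨![((4 * Z + 1 : ℕ) : ℝ), 2], ?_, ?_, fun X' Z' h' hne => ?_⟩
  · show (0 : ℝ) < ((4 * Z + 1 : ℕ) : ℝ)
    positivity
  · show (0 : ℝ) < 2
    norm_num
  · show ((4 * Z + 1 : ℕ) : ℝ) * (X : ℝ) + 2 * ((Z ^ 2 + C : ℕ) : ℝ) <
      ((4 * Z + 1 : ℕ) : ℝ) * (X' : ℝ) + 2 * ((Z' ^ 2 + C : ℕ) : ℝ)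
    exact_mod_cast parabola_exposed C (hXZ.trans h'.symm) hne.symm

/-- Exposure of the point of an exact cover among the points of all exact covers, when every such point lies
on the parabola `X + Z = T`, `Y = Z² + C`. [folklore] -/
theorem exposed_of_parabola {ι : Type*} (IsCov : Finset ι → Prop) (pt : Finset ι → Fin 2 →₀ ℕ) (T C : ℕ)
    (hcov : ∀ J, IsCov J → ∃ X Z : ℕ, X + Z = T ∧ pt J = Finsupp.single 0 X + Finsupp.single 1 (Z ^ 2 + C))
    {J : Finset ι} (hJ : IsCov J) :
    ∃ w : Fin 2 → ℝ, 0 < w 0 ∧ 0 < w 1 ∧ ∀ J', IsCov J' → pt J' ≠ pt J →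
      w 0 * ((pt J 0 : ℕ) : ℝ) + w 1 * ((pt J 1 : ℕ) : ℝ) <
        w 0 * ((pt J' 0 : ℕ) : ℝ) + w 1 * ((pt J' 1 : ℕ) : ℝ) := by
  obtain ⟨X, Z, hXZ, hq⟩ := hcov J hJ
  obtain ⟨w, hw0, hw1, hw⟩ := exposed_weights T C X Z hXZ
  refine ⟨w, hw0, hw1, fun J' hJ' hne => ?_⟩
  obtain ⟨X', Z', hXZ', hq'⟩ := hcov J' hJ'
  have hX : X' ≠ X := by
    rintro rfl
    obtain rfl : Z' = Z := by omega
    exact hne (hq'.trans hq.symm)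
  -- the two coordinates of a planar point `single 0 a + single 1 b`
  have pz : ∀ a b : ℕ, (Finsupp.single (0 : Fin 2) a + Finsupp.single 1 b : Fin 2 →₀ ℕ) 0 = a :=
    fun a b => by simp
  have po : ∀ a b : ℕ, (Finsupp.single (0 : Fin 2) a + Finsupp.single 1 b : Fin 2 →₀ ℕ) 1 = b :=
    fun a b => by simp
  rw [hq, hq', pz, po, pz, po]
  exact hw X' Z' hXZ' hX

/-! ## §3 Exact covers of the three-core family -/

section Cover

variable {x : ℕ} {ι : Type*} (e : ι ≃ Fin 3 × Finset (Fin x))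

/-- The three items `(i, S i)`, `i ∈ Fin 3`, are distinct. [folklore] -/
theorem triple_injective (S : Fin 3 → Finset (Fin x)) :
    Function.Injective fun i : Fin 3 => e.symm (i, S i) := fun i i' h => by
  simpa using congrArg (fun j => (e j).1) h

variable [DecidableEq ι]

/-- Counting inside the three-item family `{(i, S i)}`. [folklore] -/
theorem card_filter_triple (S : Fin 3 → Finset (Fin x)) (p : ι → Prop) [DecidablePred p] :
    ((univ.image fun i => e.symm (i, S i)).filter p).card =
      (univ.filter fun i => p (e.symm (i, S i))).card := by
  rw [Finset.filter_image, Finset.card_image_of_injective _ (triple_injective e S)]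

/-- Summing over the three-item family `{(i, S i)}`. [folklore] -/
theorem sum_triple {A : Type*} [AddCommMonoid A] (S : Fin 3 → Finset (Fin x))
    (c : Fin 3 × Finset (Fin x) → A) :
    ∑ j ∈ univ.image (fun i => e.symm (i, S i)), c (e j) = ∑ i, c (i, S i) := by
  rw [Finset.sum_image fun i _ i' _ h => triple_injective e S h]
  simp only [Equiv.apply_symm_apply]

variable (lab : Fin 3 × Finset (Fin x) → Fin (x + 3) → ZMod 2)

/-- An attached coordinate `u` is covered by the family `{(i, S i)}` as many times as there are `i` with
`u ∈ S i`. [folklore] -/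
theorem card_filter_triple_left (hl : ∀ p u, lab p (Fin.castAdd 3 u) = 1 ↔ u ∈ p.2)
    (S : Fin 3 → Finset (Fin x)) (u : Fin x) :
    ((univ.image fun i => e.symm (i, S i)).filter fun j => lab (e j) (Fin.castAdd 3 u) = 1).card =
      (univ.filter fun i => u ∈ S i).card := by
  rw [card_filter_triple]
  exact congrArg Finset.card (Finset.filter_congr fun i _ => by rw [hl, Equiv.apply_symm_apply])

/-- A core coordinate is covered exactly once by the family `{(i, S i)}`. [folklore] -/
theorem card_filter_triple_right (hr : ∀ p i, lab p (Fin.natAdd x i) = 1 ↔ i = p.1)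
    (S : Fin 3 → Finset (Fin x)) (i : Fin 3) :
    ((univ.image fun i => e.symm (i, S i)).filter fun j => lab (e j) (Fin.natAdd x i) = 1).card = 1 := by
  rw [card_filter_triple, Finset.card_eq_one]
  refine ⟨i, Finset.ext fun i' => ?_⟩
  simp only [Finset.mem_filter, Finset.mem_univ, true_and, hr, Equiv.apply_symm_apply,
    Finset.mem_singleton]
  exact eq_comm

/-- The family `{(i, S i)}` is an exact cover iff `S 0, S 1, S 2` partition the attached coordinates.
[folklore] -/
theorem cover_triple_iff (hl : ∀ p u, lab p (Fin.castAdd 3 u) = 1 ↔ u ∈ p.2)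
    (hr : ∀ p i, lab p (Fin.natAdd x i) = 1 ↔ i = p.1) (S : Fin 3 → Finset (Fin x)) :
    (∀ k : Fin (x + 3),
        ((univ.image fun i => e.symm (i, S i)).filter fun j => lab (e j) k = 1).card = 1) ↔
      ∀ u : Fin x, (univ.filter fun i => u ∈ S i).card = 1 := by
  refine ⟨fun h u => ?_, fun h k => ?_⟩
  · rw [← card_filter_triple_left e lab hl S u]
    exact h _
  · refine Fin.addCases (fun u => ?_) (fun i => ?_) k
    · rw [card_filter_triple_left e lab hl S u]
      exact h u
    · exact card_filter_triple_right e lab hr S i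

/-- Every exact cover is one of the families `{(i, S i)}`: the item covering core `i` is unique, and every
item covers its own core. [folklore] -/
theorem eq_triple_of_cover (hr : ∀ p i, lab p (Fin.natAdd x i) = 1 ↔ i = p.1) {J : Finset ι}
    (hJ : ∀ k : Fin (x + 3), (J.filter fun j => lab (e j) k = 1).card = 1) :
    ∃ S : Fin 3 → Finset (Fin x), J = univ.image fun i => e.symm (i, S i) := by
  have h1 : ∀ i : Fin 3, ∃ a, (J.filter fun j => lab (e j) (Fin.natAdd x i) = 1) = {a} := fun i =>
    Finset.card_eq_one.mp (hJ _)
  choose sel hsel using h1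
  have hmem : ∀ i j, j ∈ J ∧ i = (e j).1 ↔ j = sel i := fun i j => by
    simpa only [Finset.mem_filter, Finset.mem_singleton, hr] using Finset.ext_iff.mp (hsel i) j
  have hsel' : ∀ i, sel i ∈ J ∧ i = (e (sel i)).1 := fun i => (hmem i _).mpr rfl
  have hsymm : ∀ i, e.symm (i, (e (sel i)).2) = sel i := fun i =>
    e.symm_apply_eq.mpr (Prod.ext (hsel' i).2 rfl)
  refine ⟨fun i => (e (sel i)).2, Finset.ext fun j => ?_⟩
  simp only [Finset.mem_image, Finset.mem_univ, true_and, hsymm]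
  exact ⟨fun hj => ⟨(e j).1, ((hmem _ j).mp ⟨hj, rfl⟩).symm⟩, fun ⟨i, hi⟩ => hi ▸ (hsel' i).1⟩

end Cover

/-! ## §4 Partitions and the point of an exact cover -/

/-- If `S 0, S 1, S 2` partition `Fin x`, their base-`3` weights add up to `M⟦x⟧`. [folklore] -/
theorem partition_sum {x : ℕ} (S : Fin 3 → Finset (Fin x))
    (hS : ∀ u : Fin x, (univ.filter fun i => u ∈ S i).card = 1) :
    ∑ i, W⟦S i⟧ = M⟦x⟧ := by
  calc ∑ i, W⟦S i⟧ = ∑ i, ∑ u, if u ∈ S i then 3 ^ (u : ℕ) else 0 :=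
        Finset.sum_congr rfl fun i _ => (Fintype.sum_ite_mem (S i) _).symm
    _ = ∑ u, ∑ i, if u ∈ S i then 3 ^ (u : ℕ) else 0 := Finset.sum_comm
    _ = M⟦x⟧ := Finset.sum_congr rfl fun u _ => by
        rw [← Finset.sum_filter, Finset.sum_const, hS u, one_nsmul]

/-- The level sets of `f : Fin x → Fin 3` partition `Fin x`. [folklore] -/
theorem levelSets_partition {x : ℕ} (f : Fin x → Fin 3) (u : Fin x) :
    (univ.filter fun i => u ∈ univ.filter fun v => f v = i).card = 1 := by
  rw [Finset.card_eq_one]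
  exact ⟨f u, Finset.ext fun i => by simp [eq_comm]⟩

/-- The point of the exact cover `{(i, S i)}` lies on the parabola: it is `(X, Z² + 2M²)` with
`X = W⟦S 1⟧ + 2W⟦S 2⟧`, `Z = 2W⟦S 0⟧ + W⟦S 1⟧`, and `X + Z = 2M`. [folklore] -/
theorem cover_point {x : ℕ} (c : Fin 3 × Finset (Fin x) → Fin 2 →₀ ℕ)
    (hc0 : ∀ S, c (0, S) = Finsupp.single 1 (2 * W⟦S⟧ ^ 2 + 4 * M⟦x⟧ * W⟦S⟧))
    (hc1 : ∀ S, c (1, S) =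
      Finsupp.single 0 W⟦S⟧ + Finsupp.single 1 (W⟦S⟧ * W⟦Sᶜ⟧ + 3 * M⟦x⟧ * W⟦S⟧))
    (hc2 : ∀ S, c (2, S) = Finsupp.single 0 (2 * W⟦S⟧) + Finsupp.single 1 (2 * W⟦S⟧ ^ 2))
    (S : Fin 3 → Finset (Fin x)) (hS : ∀ u : Fin x, (univ.filter fun i => u ∈ S i).card = 1) :
    ∑ i, c (i, S i) = Finsupp.single 0 (W⟦S 1⟧ + 2 * W⟦S 2⟧) +
        Finsupp.single 1 ((2 * W⟦S 0⟧ + W⟦S 1⟧) ^ 2 + 2 * M⟦x⟧ ^ 2) ∧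
      W⟦S 1⟧ + 2 * W⟦S 2⟧ + (2 * W⟦S 0⟧ + W⟦S 1⟧) = 2 * M⟦x⟧ := by
  have hM : W⟦S 0⟧ + W⟦S 1⟧ + W⟦S 2⟧ = M⟦x⟧ := by
    rw [← partition_sum S hS, Fin.sum_univ_three]
  have hC : W⟦S 1⟧ + W⟦(S 1)ᶜ⟧ = M⟦x⟧ := Finset.sum_add_sum_compl (S 1) _
  refine ⟨?_, by omega⟩
  rw [Fin.sum_univ_three, hc0, hc1, hc2, ← parabola_identity _ _ _ _ _ hM hC]
  simp only [Finsupp.single_add]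
  abel

/-! ## §5 The count -/

/-- An injective family of members bounds the cardinality of a finite set from below. [folklore] -/
theorem card_le_ncard_of_injective {α β : Type*} [Fintype β] (body : α → Prop) (P : β → α)
    (hP : Function.Injective P) (hmem : ∀ b, body (P b)) (hfin : {a | body a}.Finite) :
    Fintype.card β ≤ {a | body a}.ncard := by
  classical
  calc Fintype.card β = (univ.image P).card := by
        rw [Finset.card_image_of_injective _ hP, Finset.card_univ]
    _ = ((univ.image P : Finset α) : Set α).ncard := (Set.ncard_coe_finset _).symm
    _ ≤ {a | body a}.ncard := Set.ncard_le_ncard (fun a ha => by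
        obtain ⟨b, -, rfl⟩ := Finset.mem_image.mp (Finset.mem_coe.mp ha)
        exact hmem b) hfin

/-- The three-core family, abstractly: for labels `lab` reading off `S ∪ {core i}` and costs `c` as in the
module docstring (transported along any `e : ι ≃ Fin 3 × Finset (Fin x)`), at least `3 ^ x` points are sums of
exact covers strictly exposed, by a positive weight, among all sums of exact covers. [folklore] -/
theorem threeCore_count (x : ℕ) {ι : Type*} [Fintype ι] [DecidableEq ι] (e : ι ≃ Fin 3 × Finset (Fin x))
    (lab : Fin 3 × Finset (Fin x) → Fin (x + 3) → ZMod 2) (c : Fin 3 × Finset (Fin x) → Fin 2 →₀ ℕ)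
    (hl : ∀ p u, lab p (Fin.castAdd 3 u) = 1 ↔ u ∈ p.2)
    (hr : ∀ p i, lab p (Fin.natAdd x i) = 1 ↔ i = p.1)
    (hc0 : ∀ S, c (0, S) = Finsupp.single 1 (2 * W⟦S⟧ ^ 2 + 4 * M⟦x⟧ * W⟦S⟧))
    (hc1 : ∀ S, c (1, S) =
      Finsupp.single 0 W⟦S⟧ + Finsupp.single 1 (W⟦S⟧ * W⟦Sᶜ⟧ + 3 * M⟦x⟧ * W⟦S⟧))
    (hc2 : ∀ S, c (2, S) = Finsupp.single 0 (2 * W⟦S⟧) + Finsupp.single 1 (2 * W⟦S⟧ ^ 2)) :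
    3 ^ x ≤ {q : Fin 2 →₀ ℕ | ∃ J : Finset ι,
        (∀ i : Fin (x + 3), (J.filter fun j => lab (e j) i = 1).card = 1) ∧
        ∑ j ∈ J, c (e j) = q ∧ ∃ w : Fin 2 → ℝ, 0 < w 0 ∧ 0 < w 1 ∧
        ∀ J' : Finset ι, (∀ i : Fin (x + 3), (J'.filter fun j => lab (e j) i = 1).card = 1) →
          ∑ j ∈ J', c (e j) ≠ q →
          w 0 * ((q 0 : ℕ) : ℝ) + w 1 * ((q 1 : ℕ) : ℝ) <
            w 0 * (((∑ j ∈ J', c (e j)) 0 : ℕ) : ℝ) + w 1 * (((∑ j ∈ J', c (e j)) 1 : ℕ) : ℝ)}.ncard := by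
  -- every exact cover is a triple attached to a partition, and its point lies on the parabola
  have hcov : ∀ J : Finset ι, (∀ k : Fin (x + 3), (J.filter fun j => lab (e j) k = 1).card = 1) →
      ∃ X Z : ℕ, X + Z = 2 * M⟦x⟧ ∧
        ∑ j ∈ J, c (e j) = Finsupp.single 0 X + Finsupp.single 1 (Z ^ 2 + 2 * M⟦x⟧ ^ 2) := by
    intro J hJ
    obtain ⟨S, rfl⟩ := eq_triple_of_cover e lab hr hJ
    obtain ⟨hpt, hXZ⟩ := cover_point c hc0 hc1 hc2 S ((cover_triple_iff e lab hl hr S).mp hJ)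
    exact ⟨_, _, hXZ, by rw [sum_triple, hpt]⟩
  -- the covers attached to the level sets of digit functions `f`, and their points
  have hJf : ∀ f : Fin x → Fin 3, ∀ k : Fin (x + 3),
      ((univ.image fun i => e.symm (i, univ.filter fun u => f u = i)).filter
        fun j => lab (e j) k = 1).card = 1 := fun f =>
    (cover_triple_iff e lab hl hr _).mpr (levelSets_partition f)
  have hPf : ∀ f : Fin x → Fin 3,
      ∑ j ∈ univ.image (fun i => e.symm (i, univ.filter fun u => f u = i)), c (e j) =
        Finsupp.single 0 (W⟦(univ.filter fun u => f u = 1)⟧ + 2 * W⟦(univ.filter fun u => f u = 2)⟧) +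
          Finsupp.single 1 ((2 * W⟦(univ.filter fun u => f u = 0)⟧ + W⟦(univ.filter fun u => f u = 1)⟧) ^ 2 +
            2 * M⟦x⟧ ^ 2) := fun f => by
    rw [sum_triple]
    exact (cover_point c hc0 hc1 hc2 (fun i => univ.filter fun u => f u = i) (levelSets_partition f)).1
  -- `f ↦ point` is injective: the first coordinate is the base-`3` digit sum of `f`
  have hinj : Function.Injective fun f : Fin x → Fin 3 =>
      ∑ j ∈ univ.image (fun i => e.symm (i, univ.filter fun u => f u = i)), c (e j) := by
    intro f f' h
    have pz : ∀ a b : ℕ, (Finsupp.single (0 : Fin 2) a + Finsupp.single 1 b : Fin 2 →₀ ℕ) 0 = a :=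
      fun a b => by simp
    have h0 := congrArg (fun q : Fin 2 →₀ ℕ => q 0) h
    simp only [hPf, pz, digitSum_eq] at h0
    exact digitSum_injective x f f' h0
  rw [show 3 ^ x = Fintype.card (Fin x → Fin 3) by simp]
  apply card_le_ncard_of_injective _ _ hinj
  · intro f
    exact ⟨_, hJf f, rfl, exposed_of_parabola
      (fun J => ∀ k : Fin (x + 3), (J.filter fun j => lab (e j) k = 1).card = 1)
      (fun J => ∑ j ∈ J, c (e j)) _ _ hcov (hJf f)⟩
  · refine (Set.finite_range fun J : Finset ι => ∑ j ∈ J, c (e j)).subset ?_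
    rintro q ⟨J, -, hq, -⟩
    exact ⟨J, hq⟩

end ThreeCoreExposedAux

/-- STUB P5 — **the three-core exact-cover family has `3 ^ x` strictly positively exposed points.**  There are
labels `g : Fin (3 · 2^x) → (Fin (x + 3) → ZMod 2)` and costs `ε : Fin (3 · 2^x) → ℕ²` such that at least `3 ^ x`
points `q` are the cost of an exact cover (`#{j ∈ J : g j i = 1} = 1` for every coordinate `i`) and are strictly
exposed among the costs of all exact covers by a weight `w` with both coordinates positive.  Construction: items
`(i, S)`, `i ∈ Fin 3`, `S ⊆ Fin x`, labelled by `S ∪ {core i}`, with costs `(0, 2W² + 4MW)`, `(W, W·W(Sᶜ) + 3MW)`,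
`(2W, 2W²)` (`W = Σ_{u∈S} 3^u`, `M = Σ_u 3^u`); exact covers are the level-set triples of the `3 ^ x` digit
functions `f : Fin x → Fin 3`, with pairwise distinct points on the parabola `(X, (2M - X)² + 2M²)`,
`X = Σ_u f(u) 3^u`, each exposed by `w = (4(2M - X) + 1, 2)`. [folklore] -/
theorem stub_threeCoreExposed (x : ℕ) :
    ∃ (g : Fin (3 * 2 ^ x) → Fin (x + 3) → ZMod 2) (ε : Fin (3 * 2 ^ x) → (Fin 2 →₀ ℕ)),
      3 ^ x ≤ {q : Fin 2 →₀ ℕ | ∃ J : Finset (Fin (3 * 2 ^ x)),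
        (∀ i : Fin (x + 3), (J.filter fun j => g j i = 1).card = 1) ∧
        ∑ j ∈ J, ε j = q ∧ ∃ w : Fin 2 → ℝ, 0 < w 0 ∧ 0 < w 1 ∧
        ∀ J' : Finset (Fin (3 * 2 ^ x)), (∀ i : Fin (x + 3), (J'.filter fun j => g j i = 1).card = 1) →
          ∑ j ∈ J', ε j ≠ q →
          w 0 * ((q 0 : ℕ) : ℝ) + w 1 * ((q 1 : ℕ) : ℝ) <
            w 0 * (((∑ j ∈ J', ε j) 0 : ℕ) : ℝ) + w 1 * (((∑ j ∈ J', ε j) 1 : ℕ) : ℝ)}.ncard := by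
  obtain ⟨e⟩ : Nonempty (Fin (3 * 2 ^ x) ≃ Fin 3 × Finset (Fin x)) :=
    ⟨(Fintype.equivFinOfCardEq (by simp)).symm⟩
  exact ⟨_, _, ThreeCoreExposedAux.threeCore_count x e
    (fun p => Fin.append (fun u : Fin x => if u ∈ p.2 then (1 : ZMod 2) else 0)
      (fun i : Fin 3 => if i = p.1 then (1 : ZMod 2) else 0))
    (fun p => ![Finsupp.single 1 (2 * W⟦p.2⟧ ^ 2 + 4 * M⟦x⟧ * W⟦p.2⟧),
      Finsupp.single 0 W⟦p.2⟧ + Finsupp.single 1 (W⟦p.2⟧ * W⟦p.2ᶜ⟧ + 3 * M⟦x⟧ * W⟦p.2⟧),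
      Finsupp.single 0 (2 * W⟦p.2⟧) + Finsupp.single 1 (2 * W⟦p.2⟧ ^ 2)] p.1)
    (fun p u => by simp only [Fin.append_left]; exact Ne.ite_eq_left_iff one_ne_zero)
    (fun p i => by simp only [Fin.append_right]; exact Ne.ite_eq_left_iff one_ne_zero)
    (fun S => rfl) (fun S => rfl) (fun S => rfl)⟩

end Summit.ValiantsHypothesis.ValiantsHypothesis.Theorems.NewtonUnitEquationsNewtonTauWeak

end
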